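import Literature.MathematicalPhysics.QuantumLattice.LayeredHubbardGrandCanonicalVariationalPressure
import Literature.MathematicalPhysics.QuantumLattice.TIStateMeanEntropy
import HarnessLib

/-!
# Coexisting equilibrium phases of lattice fermions at `T > 0`: Griffiths windows shared by all equilibria, jump bounds from three
# pressures, the approximate face property, and the LAYERED CRYSTAL: density / magnetisation jumps of coexisting 3D thermal phases are
# bounded by 2D grand-canonical pressures

Topic `Literature/MathematicalPhysics/QuantumLattice` (family `hubbard`; crew hubbard-fast S2, D-0096 (iii) «competing orders» × «interlayer
coupling» at `T > 0`). `TIStateMeanEntropy` proved that for every finite-range interaction the variational equilibrium states form a FACE of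
the simplex of translation-invariant states (components of an equilibrium mixture are equilibria), and `TIVariationalPressure` /
`LayeredVariationalPressure` the Griffiths tangent inequalities (exact / with slack). Consequences, for every model and then for the layered
`t–t'` Hubbard crystal:

* §1 **All equilibria at one parameter point share the Griffiths windows**: for an equilibrium `ω` at couplings `θ` of a linear family
  `Ψ₀ + Σθ_aΨ_a` (`β, δ > 0`): `e_a(ω) ∈ [(P(θ) − P(θ+δ1_a))/(βδ), (P(θ−δ1_a) − P(θ))/(βδ)]` (`IsVarEquilibrium.meanEnergy_mem_Icc`), hence
  **two equilibria (two coexisting phases) differ in every conjugate density by at most the window width**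
  `(P(θ+δ1_a) + P(θ−δ1_a) − 2P(θ))/(βδ)` (`IsVarEquilibrium.abs_meanEnergy_sub_le`) — three pressure values bound every first-order jump;
  the phases of an equilibrium MIXTURE inherit it through the face property (`IsVarEquilibrium.abs_meanEnergy_sub_le_of_mix`).
* §2 **Approximate versions**: two `ε`-approximate equilibria differ by at most `(P(θ+δ) + P(θ−δ) − 2P(θ) + 2ε)/(βδ)`
  (`abs_meanEnergy_sub_le_of_approx`); the APPROXIMATE FACE: if `λν₁ + (1−λ)ν₂` is an `ε`-approximate equilibrium then `ν₁` is an
  `ε/λ`-approximate and `ν₂` an `ε/(1−λ)`-approximate equilibrium (`approx_of_mix_left/right`, affinity of `s̄ − βe`).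
* §3 **THE LAYERED `t–t'` HUBBARD CRYSTAL** (`gcLayeredHubbardTTPrime`, `β > 0`, `U ≥ 0`, interlayer amplitudes `tz_b` along `w_b`,
  `(w_b)₀ ≠ 0`): if a 3D thermal equilibrium state at `(β; t,t',U; μ,h)` is a non-trivial mixture of translation-invariant states `ω₁, ω₂`
  (coexisting phases), both are 3D equilibria (face), so by `LayeredHubbardGrandCanonicalVariationalPressure` §4 their densities and
  magnetisations lie in the 2D windows, and **the density jump is at most
  `(P₂(μ+δ) + P₂(μ−δ) − 2P₂(μ) + 2β(4/π)Σ|tz|)/(βδ)`**, `P₂ = gcPressureTT'Zeeman` (`IsVarEquilibrium.abs_density_sub_le_of_gcLayered_mix`),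
  likewise the magnetisation jump in `h` (`…abs_spinImbalance_sub_le_of_gcLayered_mix`): 2D GRAND-CANONICAL PRESSURE CERTIFICATES BOUND THE
  FIRST-ORDER JUMPS OF 3D LAYERED CRYSTALS, the interlayer coupling entering only through `2(4/π)Σ|tz|/δ`.

Everything is PROVED; no definition, no named fact, no number. HONEST SCOPE: variational (TI) equilibrium states; macroscopic phase
coexistence = non-trivial convex decomposition into TI states; no statement about non-translation-invariant (e.g. staggered) order.

## Mathlib / tree search

REUSED: `IsVarEquilibrium`, `varPressure`, `sub_mul_le_varPressure` (`TIVariationalPressure`); `meanEnergy_mem_Icc_of_approx`,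
`varPressure_sub_mul_le_update_of_approx` (`LayeredVariationalPressure`); `varFunctional_mix`, `IsVarEquilibrium.of_mix_left/right`
(`TIStateMeanEntropy`); `IsVarEquilibrium.density_mem_Icc_of_gcLayered`, `…spinImbalance_mem_Icc_of_gcLayered` (`LayeredHubbardGrandCanonicalVariationalPressure`);
`mix`, `IsTranslationInvariant.mix`, `mix_comm`. `lean search 'abs_meanEnergy_sub_le|jump|coexist.*varPressure'` (2026-08-28): the `t–t'`-specific
`HubbardTTPrimeThermalPhaseCoexistence(Jumps)` (torus-limit GC states); nothing model-independent, nothing layered.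

## References

* R. B. Israel, *Convexity in the Theory of Lattice Gases* (1979), Thm. I.2.4 (tangent functionals at a point form a face; one-sided
  derivatives bound them). [cite: Israel1979, Thm. I.2.4]
* R. B. Griffiths, J. Math. Phys. 5 (1964) 1215, eq. (39) (convexity brackets). [cite: Griffiths1964, Eq. (39) and Fig. 3]
* H. Araki, H. Moriya, Rev. Math. Phys. 15 (2003) 93, Thm. 12.11 (variational principle ⇔ equilibrium). [cite: ArakiMoriya2003, Theorem 12.11]
* O. Bratteli, A. Kishimoto, D. W. Robinson, Commun. Math. Phys. 64 (1978) 41, Thm. 2. [cite: BratteliKishimotoRobinson1978, Thm. 2 (condition 2)]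
-/

noncomputable section

open scoped ComplexOrder BigOperators
open Finset Literature.InformationTheory.Entropy

namespace Literature.MathematicalPhysics.QuantumLattice

open Matrix HubbardWave0 Literature.Probability.LatticeModels ThermodynamicLimit

namespace InfVolFermionState

variable {d : ℕ} {β : ℝ} {R ε : ℝ} {ι : Type*} [Fintype ι] [DecidableEq ι] {Ψ₀ : FermionInteraction d}
  {Ψv : ι → FermionInteraction d} {θ : ι → ℝ}

/-! ### §1 All equilibria at one point share the Griffiths windows; jump bounds -/

/-- An equilibrium state is a `0`-approximate equilibrium. [cite: ArakiMoriya2003, Theorem 12.11] -/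
theorem IsVarEquilibrium.approx_zero {Ψ : FermionInteraction d} {ω : InfVolFermionState d} (h : ω.IsVarEquilibrium β Ψ R) :
    Ψ.varPressure β R - 0 ≤ ω.entropyDensitySup - β * ω.meanEnergy Ψ R := by
  rw [sub_zero, h.2]

/-- **GRIFFITHS WINDOW for every equilibrium state** at couplings `θ` (`β, δ > 0`):
`(P(θ) − P(θ+δ1_a))/(βδ) ≤ e_a(ω) ≤ (P(θ−δ1_a) − P(θ))/(βδ)`. [cite: Griffiths1964, Eq. (39) and Fig. 3] [cite: Israel1979, Thm. I.2.4] -/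
theorem IsVarEquilibrium.meanEnergy_mem_Icc {ω : InfVolFermionState d} (hβ : 0 < β)
    (h : ω.IsVarEquilibrium β (FermionInteraction.linearFamily Ψ₀ Ψv θ) R) (a : ι) {δ : ℝ} (hδ : 0 < δ) :
    ω.meanEnergy (Ψv a) R ∈ Set.Icc
      (((FermionInteraction.linearFamily Ψ₀ Ψv θ).varPressure β R -
          (FermionInteraction.linearFamily Ψ₀ Ψv (θ + Pi.single a δ)).varPressure β R) / (β * δ))
      (((FermionInteraction.linearFamily Ψ₀ Ψv (θ + Pi.single a (-δ))).varPressure β R -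
          (FermionInteraction.linearFamily Ψ₀ Ψv θ).varPressure β R) / (β * δ)) := by
  have h0 := meanEnergy_mem_Icc_of_approx h.1 hβ h.approx_zero a hδ
  simp only [sub_zero, add_zero] at h0
  exact h0

/-- **Two `ε`-approximate equilibria at the same point differ in every conjugate density by at most
`(P(θ+δ1_a) + P(θ−δ1_a) − 2P(θ) + 2ε)/(βδ)`.** [cite: Griffiths1964, Eq. (39) and Fig. 3] [cite: Israel1979, Thm. I.2.4] -/
theorem abs_meanEnergy_sub_le_of_approx {ν₁ ν₂ : InfVolFermionState d} (hβ : 0 < β) (hν₁ : ν₁.IsTranslationInvariant)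
    (hν₂ : ν₂.IsTranslationInvariant)
    (h₁ : (FermionInteraction.linearFamily Ψ₀ Ψv θ).varPressure β R - ε ≤
      ν₁.entropyDensitySup - β * ν₁.meanEnergy (FermionInteraction.linearFamily Ψ₀ Ψv θ) R)
    (h₂ : (FermionInteraction.linearFamily Ψ₀ Ψv θ).varPressure β R - ε ≤
      ν₂.entropyDensitySup - β * ν₂.meanEnergy (FermionInteraction.linearFamily Ψ₀ Ψv θ) R)
    (a : ι) {δ : ℝ} (hδ : 0 < δ) :
    |ν₁.meanEnergy (Ψv a) R - ν₂.meanEnergy (Ψv a) R| ≤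
      ((FermionInteraction.linearFamily Ψ₀ Ψv (θ + Pi.single a δ)).varPressure β R +
          (FermionInteraction.linearFamily Ψ₀ Ψv (θ + Pi.single a (-δ))).varPressure β R -
          2 * (FermionInteraction.linearFamily Ψ₀ Ψv θ).varPressure β R + 2 * ε) / (β * δ) := by
  have w₁ := meanEnergy_mem_Icc_of_approx hν₁ hβ h₁ a hδ
  have w₂ := meanEnergy_mem_Icc_of_approx hν₂ hβ h₂ a hδ
  have hβδ : 0 < β * δ := mul_pos hβ hδ
  rw [abs_le]
  constructor
  · have e : -(((FermionInteraction.linearFamily Ψ₀ Ψv (θ + Pi.single a δ)).varPressure β R +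
          (FermionInteraction.linearFamily Ψ₀ Ψv (θ + Pi.single a (-δ))).varPressure β R -
          2 * (FermionInteraction.linearFamily Ψ₀ Ψv θ).varPressure β R + 2 * ε) / (β * δ)) =
        ((FermionInteraction.linearFamily Ψ₀ Ψv θ).varPressure β R -
            (FermionInteraction.linearFamily Ψ₀ Ψv (θ + Pi.single a δ)).varPressure β R - ε) / (β * δ) -
          ((FermionInteraction.linearFamily Ψ₀ Ψv (θ + Pi.single a (-δ))).varPressure β R -
            (FermionInteraction.linearFamily Ψ₀ Ψv θ).varPressure β R + ε) / (β * δ) := by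
      field_simp
      ring
    rw [e]
    linarith [w₁.1, w₂.2]
  · have e : ((FermionInteraction.linearFamily Ψ₀ Ψv (θ + Pi.single a δ)).varPressure β R +
          (FermionInteraction.linearFamily Ψ₀ Ψv (θ + Pi.single a (-δ))).varPressure β R -
          2 * (FermionInteraction.linearFamily Ψ₀ Ψv θ).varPressure β R + 2 * ε) / (β * δ) =
        ((FermionInteraction.linearFamily Ψ₀ Ψv (θ + Pi.single a (-δ))).varPressure β R -
            (FermionInteraction.linearFamily Ψ₀ Ψv θ).varPressure β R + ε) / (β * δ) -
          ((FermionInteraction.linearFamily Ψ₀ Ψv θ).varPressure β R -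
            (FermionInteraction.linearFamily Ψ₀ Ψv (θ + Pi.single a δ)).varPressure β R - ε) / (β * δ) := by
      field_simp
      ring
    rw [e]
    linarith [w₁.2, w₂.1]

/-- **JUMP BOUND FROM THREE PRESSURES**: two equilibrium states at the same couplings `θ` (two coexisting phases) differ in every
conjugate density by at most `(P(θ+δ1_a) + P(θ−δ1_a) − 2P(θ))/(βδ)`. [cite: Griffiths1964, Eq. (39) and Fig. 3] [cite: Israel1979, Thm. I.2.4] -/
theorem IsVarEquilibrium.abs_meanEnergy_sub_le {ω₁ ω₂ : InfVolFermionState d} (hβ : 0 < β)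
    (h₁ : ω₁.IsVarEquilibrium β (FermionInteraction.linearFamily Ψ₀ Ψv θ) R)
    (h₂ : ω₂.IsVarEquilibrium β (FermionInteraction.linearFamily Ψ₀ Ψv θ) R) (a : ι) {δ : ℝ} (hδ : 0 < δ) :
    |ω₁.meanEnergy (Ψv a) R - ω₂.meanEnergy (Ψv a) R| ≤
      ((FermionInteraction.linearFamily Ψ₀ Ψv (θ + Pi.single a δ)).varPressure β R +
          (FermionInteraction.linearFamily Ψ₀ Ψv (θ + Pi.single a (-δ))).varPressure β R -
          2 * (FermionInteraction.linearFamily Ψ₀ Ψv θ).varPressure β R) / (β * δ) := by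
  have h := abs_meanEnergy_sub_le_of_approx hβ h₁.1 h₂.1 h₁.approx_zero h₂.approx_zero a hδ
  rw [mul_zero, add_zero] at h
  exact h

/-- **Phases of an equilibrium mixture obey the jump bound** (`0 < λ < 1`, `d ≥ 1`; the face property makes both components equilibria).
[cite: Israel1979, Thm. I.2.4] [cite: ArakiMoriya2003, Theorem 12.11] -/
theorem IsVarEquilibrium.abs_meanEnergy_sub_le_of_mix (hd : 0 < d) {ω₁ ω₂ : InfVolFermionState d} (hβ : 0 < β)
    (hω₁ : ω₁.IsTranslationInvariant) (hω₂ : ω₂.IsTranslationInvariant) {s : ℝ} {hs₀ : 0 ≤ s} {hs₁ : s ≤ 1} (hs0 : 0 < s)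
    (hs1 : s < 1) (h : (InfVolFermionState.mix s hs₀ hs₁ ω₁ ω₂).IsVarEquilibrium β (FermionInteraction.linearFamily Ψ₀ Ψv θ) R) (a : ι) {δ : ℝ}
    (hδ : 0 < δ) :
    |ω₁.meanEnergy (Ψv a) R - ω₂.meanEnergy (Ψv a) R| ≤
      ((FermionInteraction.linearFamily Ψ₀ Ψv (θ + Pi.single a δ)).varPressure β R +
          (FermionInteraction.linearFamily Ψ₀ Ψv (θ + Pi.single a (-δ))).varPressure β R -
          2 * (FermionInteraction.linearFamily Ψ₀ Ψv θ).varPressure β R) / (β * δ) :=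
  IsVarEquilibrium.abs_meanEnergy_sub_le hβ (IsVarEquilibrium.of_mix_left hd hs0 hω₁ hω₂ h)
    (IsVarEquilibrium.of_mix_right hd hs1 hω₁ hω₂ h) a hδ

/-! ### §2 The approximate face property -/

/-- **APPROXIMATE FACE, left component**: if `λν₁ + (1−λ)ν₂` is an `ε`-approximate equilibrium (`λ > 0`, `d ≥ 1`), then `ν₁` is an
`ε/λ`-approximate equilibrium. [cite: Israel1979, Thm. I.2.4] -/
theorem approx_of_mix_left (hd : 0 < d) {Ψ : FermionInteraction d} {ν₁ ν₂ : InfVolFermionState d} (hν₁ : ν₁.IsTranslationInvariant)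
    (hν₂ : ν₂.IsTranslationInvariant) {s : ℝ} {hs₀ : 0 ≤ s} {hs₁ : s ≤ 1} (hs0 : 0 < s)
    (h : Ψ.varPressure β R - ε ≤ (InfVolFermionState.mix s hs₀ hs₁ ν₁ ν₂).entropyDensitySup - β * (InfVolFermionState.mix s hs₀ hs₁ ν₁ ν₂).meanEnergy Ψ R) :
    Ψ.varPressure β R - ε / s ≤ ν₁.entropyDensitySup - β * ν₁.meanEnergy Ψ R := by
  rw [varFunctional_mix hd s hs₀ hs₁ hν₁ hν₂] at h
  have h₂ := Ψ.sub_mul_le_varPressure β R hν₂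
  have key : s * (Ψ.varPressure β R - ε / s) ≤ s * (ν₁.entropyDensitySup - β * ν₁.meanEnergy Ψ R) := by
    rw [mul_sub, mul_div_cancel₀ _ (ne_of_gt hs0)]
    nlinarith [mul_le_mul_of_nonneg_left h₂ (sub_nonneg.2 hs₁)]
  exact le_of_mul_le_mul_left key hs0

/-- **APPROXIMATE FACE, right component** (`λ < 1`): `ν₂` is an `ε/(1−λ)`-approximate equilibrium. [cite: Israel1979, Thm. I.2.4] -/
theorem approx_of_mix_right (hd : 0 < d) {Ψ : FermionInteraction d} {ν₁ ν₂ : InfVolFermionState d} (hν₁ : ν₁.IsTranslationInvariant)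
    (hν₂ : ν₂.IsTranslationInvariant) {s : ℝ} {hs₀ : 0 ≤ s} {hs₁ : s ≤ 1} (hs1 : s < 1)
    (h : Ψ.varPressure β R - ε ≤ (InfVolFermionState.mix s hs₀ hs₁ ν₁ ν₂).entropyDensitySup - β * (InfVolFermionState.mix s hs₀ hs₁ ν₁ ν₂).meanEnergy Ψ R) :
    Ψ.varPressure β R - ε / (1 - s) ≤ ν₂.entropyDensitySup - β * ν₂.meanEnergy Ψ R := by
  rw [mix_comm] at h
  exact approx_of_mix_left hd hν₂ hν₁ (by linarith) h

end InfVolFermionState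

/-! ### §3 The layered `t–t'` Hubbard crystal: jumps of coexisting 3D phases from 2D pressures -/

section Layered

variable {κ : Type*} [Fintype κ]

/-- **DENSITY JUMP OF COEXISTING 3D THERMAL PHASES FROM 2D PRESSURES.** Let a 3D thermal equilibrium state of the layered grand-canonical
`t–t'` crystal at `(β; t,t',U; μ,h)` (`β > 0`, `U ≥ 0`) be a non-trivial mixture `λω₁ + (1−λ)ω₂` of translation-invariant states. Then for
every `δ > 0`, with `P(·) = gcPressureTT'Zeeman β t t' U · h` and `ε = β(4/π)Σ_b|tz_b|`:
`|ρ(ω₁) − ρ(ω₂)| ≤ (P(μ+δ) + P(μ−δ) − 2P(μ) + 2ε)/(βδ)`. [cite: Griffiths1964, Eq. (39) and Fig. 3] [cite: BratteliKishimotoRobinson1978, Thm. 2 (condition 2)] -/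
theorem InfVolFermionState.IsVarEquilibrium.abs_density_sub_le_of_gcLayered_mix {β : ℝ} (hβ : 0 < β) (t t' : ℝ) {U : ℝ}
    (hU : 0 ≤ U) (μ hz : ℝ) {w : κ → Site 3} (hw : ∀ b, w b 0 ≠ 0) (tz : κ → ℝ) {R' : ℝ} (hR' : 1 ≤ R')
    (hwR' : ∀ b, w b ∈ thicken ({0} : Finset (Site 3)) R') {ω₁ ω₂ : InfVolFermionState 3} (hω₁ : ω₁.IsTranslationInvariant)
    (hω₂ : ω₂.IsTranslationInvariant) {s : ℝ} {hs₀ : 0 ≤ s} {hs₁ : s ≤ 1} (hs0 : 0 < s) (hs1 : s < 1)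
    (h : (InfVolFermionState.mix s hs₀ hs₁ ω₁ ω₂).IsVarEquilibrium β (gcLayeredHubbardTTPrime t t' U μ hz w tz) R')
    {δ : ℝ} (hδ : 0 < δ) :
    |ω₁.density - ω₂.density| ≤
      (gcPressureTT'Zeeman β t t' U (μ + δ) hz + gcPressureTT'Zeeman β t t' U (μ - δ) hz - 2 * gcPressureTT'Zeeman β t t' U μ hz +
        2 * (β * (4 / Real.pi * ∑ b, |tz b|))) / (β * δ) := by
  have h₁ := InfVolFermionState.IsVarEquilibrium.of_mix_left (by norm_num : 0 < 3) hs0 hω₁ hω₂ h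
  have h₂ := InfVolFermionState.IsVarEquilibrium.of_mix_right (by norm_num : 0 < 3) hs1 hω₁ hω₂ h
  have w₁ := h₁.density_mem_Icc_of_gcLayered hβ t t' hU μ hz hw tz hR' hwR' hδ
  have w₂ := h₂.density_mem_Icc_of_gcLayered hβ t t' hU μ hz hw tz hR' hwR' hδ
  have hβδ : 0 < β * δ := mul_pos hβ hδ
  set Pp := gcPressureTT'Zeeman β t t' U (μ + δ) hz
  set Pm := gcPressureTT'Zeeman β t t' U (μ - δ) hz
  set P0 := gcPressureTT'Zeeman β t t' U μ hz
  set E := β * (4 / Real.pi * ∑ b, |tz b|)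
  rw [abs_le]
  constructor
  · have e : -((Pp + Pm - 2 * P0 + 2 * E) / (β * δ)) = (P0 - Pm - E) / (β * δ) - (Pp - P0 + E) / (β * δ) := by
      field_simp; ring
    rw [e]; linarith [w₁.1, w₂.2]
  · have e : (Pp + Pm - 2 * P0 + 2 * E) / (β * δ) = (Pp - P0 + E) / (β * δ) - (P0 - Pm - E) / (β * δ) := by
      field_simp; ring
    rw [e]; linarith [w₁.2, w₂.1]

/-- **MAGNETISATION JUMP OF COEXISTING 3D THERMAL PHASES FROM 2D PRESSURES** (same, in the field): with `P(·) = gcPressureTT'Zeeman β t t' U μ ·`,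
`|m(ω₁) − m(ω₂)| ≤ (P(h+δ) + P(h−δ) − 2P(h) + 2ε)/(βδ)`. [cite: Griffiths1964, Eq. (39) and Fig. 3] [cite: BratteliKishimotoRobinson1978, Thm. 2 (condition 2)] -/
theorem InfVolFermionState.IsVarEquilibrium.abs_spinImbalance_sub_le_of_gcLayered_mix {β : ℝ} (hβ : 0 < β) (t t' : ℝ) {U : ℝ}
    (hU : 0 ≤ U) (μ hz : ℝ) {w : κ → Site 3} (hw : ∀ b, w b 0 ≠ 0) (tz : κ → ℝ) {R' : ℝ} (hR' : 1 ≤ R')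
    (hwR' : ∀ b, w b ∈ thicken ({0} : Finset (Site 3)) R') {ω₁ ω₂ : InfVolFermionState 3} (hω₁ : ω₁.IsTranslationInvariant)
    (hω₂ : ω₂.IsTranslationInvariant) {s : ℝ} {hs₀ : 0 ≤ s} {hs₁ : s ≤ 1} (hs0 : 0 < s) (hs1 : s < 1)
    (h : (InfVolFermionState.mix s hs₀ hs₁ ω₁ ω₂).IsVarEquilibrium β (gcLayeredHubbardTTPrime t t' U μ hz w tz) R')
    {δ : ℝ} (hδ : 0 < δ) :
    |ω₁.meanEnergy (spinImbalanceInteraction 3) R' - ω₂.meanEnergy (spinImbalanceInteraction 3) R'| ≤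
      (gcPressureTT'Zeeman β t t' U μ (hz + δ) + gcPressureTT'Zeeman β t t' U μ (hz - δ) - 2 * gcPressureTT'Zeeman β t t' U μ hz +
        2 * (β * (4 / Real.pi * ∑ b, |tz b|))) / (β * δ) := by
  have h₁ := InfVolFermionState.IsVarEquilibrium.of_mix_left (by norm_num : 0 < 3) hs0 hω₁ hω₂ h
  have h₂ := InfVolFermionState.IsVarEquilibrium.of_mix_right (by norm_num : 0 < 3) hs1 hω₁ hω₂ h
  have w₁ := h₁.spinImbalance_mem_Icc_of_gcLayered hβ t t' hU μ hz hw tz hR' hwR' hδ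
  have w₂ := h₂.spinImbalance_mem_Icc_of_gcLayered hβ t t' hU μ hz hw tz hR' hwR' hδ
  have hβδ : 0 < β * δ := mul_pos hβ hδ
  set Pp := gcPressureTT'Zeeman β t t' U μ (hz + δ)
  set Pm := gcPressureTT'Zeeman β t t' U μ (hz - δ)
  set P0 := gcPressureTT'Zeeman β t t' U μ hz
  set E := β * (4 / Real.pi * ∑ b, |tz b|)
  rw [abs_le]
  constructor
  · have e : -((Pp + Pm - 2 * P0 + 2 * E) / (β * δ)) = (P0 - Pm - E) / (β * δ) - (Pp - P0 + E) / (β * δ) := by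
      field_simp; ring
    rw [e]; linarith [w₁.1, w₂.2]
  · have e : (Pp + Pm - 2 * P0 + 2 * E) / (β * δ) = (Pp - P0 + E) / (β * δ) - (P0 - Pm - E) / (β * δ) := by
      field_simp; ring
    rw [e]; linarith [w₁.2, w₂.1]

end Layered

end Literature.MathematicalPhysics.QuantumLattice

end
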